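import Summits.KontsevichZagierPeriods.KontsevichZagierPeriods.Theorems.LinRedNormalFormArrangementNormalFormStubRebaseSimplePosOneFibreApex

/-!
# Stub `stub_rebaseSimplePosOne`, residual hypothesis `Hpar` (crux `ArrangementNormalForm`,
line `janus-bands`, v6.2) — sub-part `ParCoords`

Coordinate bookkeeping for the UNFOLD–EXCHANGE treatment of thin parallel bands (sub-part
`ParExchange`). Three coordinate systems on `ℝ^{B+3}` / `ℝ^{B+2}` occur:
* the INPUT text `z = (x', y, t')` (base `(x', y)`, fibre `t'`: `y = z (castAdd 1 (last B))`,
  `t' = z (natAdd (B+1) 0)`);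
* the OUTPUT text `w = (x', t', σ)` (base `(x', t')`, fibre `σ`), read with the SAME literal
  conventions (`t' = w (castAdd 1 (last B))`, `σ = w (natAdd (B+1) 0)`);
* the unfolded space `ℝ^{B+3}` in the order `(x', y, t', σ)` (unfolding adds `σ` LAST) and in
  the order `(x', t', σ, y)` (the exchange integrates `y` out LAST); they differ by the 3-cycle
  `e₃` of the last three indices.
This file proves: the input point `inPt w y` with output base `w` and distinguished coordinate
`y` and its coordinates; the identity `w ∘ e₃ = snoc (inPt (init w) (w last)) (σ (init w))`
(`RebasePos.comp_cycle3`); bounds for `x'`-affine forms; and the boundedness of the output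
literal domain over a bounded input band with non-degenerate `y`-sections
(`RebasePos.isBounded_outDom`). No new definitions are introduced (all maps are explicit terms).

References: M. Kontsevich, D. Zagier, *Periods* (2001), §1.2.
-/

noncomputable section

open Set MeasureTheory MvPolynomial
open Literature.NumberTheory.Transcendental Literature.ModelTheory.ExponentialFields

namespace Summit.KontsevichZagierPeriods.ArrangementNormalForm.JanusBands

namespace RebasePos

open SeparatePos IntegrateOut

section Coords

variable {B : ℕ}

/-- The `x'`-coordinates of the input point `inPt w y`. -/
@[simp] theorem inPt_x (w : Fin (B + 1 + 1) → ℝ) (y : ℝ) (i : Fin B) :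
    (Fin.append (Fin.snoc (fun i : Fin B => w (Fin.castAdd 1 (Fin.castSucc i))) y)
      (fun _ : Fin 1 => w (Fin.castAdd 1 (Fin.last B))) : Fin (B + 1 + 1) → ℝ)
      (Fin.castAdd 1 (Fin.castSucc i)) = w (Fin.castAdd 1 (Fin.castSucc i)) := by
  rw [Fin.append_left, Fin.snoc_castSucc]

/-- The distinguished coordinate of the input point `inPt w y`. -/
@[simp] theorem inPt_y (w : Fin (B + 1 + 1) → ℝ) (y : ℝ) :
    (Fin.append (Fin.snoc (fun i : Fin B => w (Fin.castAdd 1 (Fin.castSucc i))) y)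
      (fun _ : Fin 1 => w (Fin.castAdd 1 (Fin.last B))) : Fin (B + 1 + 1) → ℝ)
      (Fin.castAdd 1 (Fin.last B)) = y := by
  rw [Fin.append_left, Fin.snoc_last]

/-- The fibre coordinate of the input point `inPt w y`. -/
@[simp] theorem inPt_t (w : Fin (B + 1 + 1) → ℝ) (y : ℝ) (k : Fin 1) :
    (Fin.append (Fin.snoc (fun i : Fin B => w (Fin.castAdd 1 (Fin.castSucc i))) y)
      (fun _ : Fin 1 => w (Fin.castAdd 1 (Fin.last B))) : Fin (B + 1 + 1) → ℝ)
      (Fin.natAdd (B + 1) k) = w (Fin.castAdd 1 (Fin.last B)) := by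
  rw [Fin.append_right]

/-- The output base vector of the input point `inPt w y` is the base vector of `w`. -/
theorem outBase_inPt (w : Fin (B + 1 + 1) → ℝ) (y : ℝ) :
    (Fin.snoc (fun i : Fin B => (Fin.append (Fin.snoc (fun i : Fin B => w (Fin.castAdd 1 (Fin.castSucc i))) y)
      (fun _ : Fin 1 => w (Fin.castAdd 1 (Fin.last B))) : Fin (B + 1 + 1) → ℝ) (Fin.castAdd 1 (Fin.castSucc i)))
      ((Fin.append (Fin.snoc (fun i : Fin B => w (Fin.castAdd 1 (Fin.castSucc i))) y)
      (fun _ : Fin 1 => w (Fin.castAdd 1 (Fin.last B))) : Fin (B + 1 + 1) → ℝ) (Fin.natAdd (B + 1) 0)) :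
      Fin (B + 1) → ℝ) = fun j => w (Fin.castAdd 1 j) := by
  funext j
  refine Fin.lastCases ?_ (fun i => ?_) j
  · rw [Fin.snoc_last, inPt_t]
  · rw [Fin.snoc_castSucc, inPt_x]

/-- `x'`-affine forms at the input point `inPt w y`. -/
@[simp] theorem affB_inPt (d : (Fin B → ℚ) × ℚ) (w : Fin (B + 1 + 1) → ℝ) (y : ℝ) :
    affB B 1 d (Fin.append (Fin.snoc (fun i : Fin B => w (Fin.castAdd 1 (Fin.castSucc i))) y)
      (fun _ : Fin 1 => w (Fin.castAdd 1 (Fin.last B))) : Fin (B + 1 + 1) → ℝ) = affB B 1 d w := by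
  simp only [affB, inPt_x]

/-- Evaluation of a full-base form at the output base vector of `inPt w y`. -/
theorem ev_inPt (c : (Fin (B + 1) → ℚ) × ℚ) (w : Fin (B + 1 + 1) → ℝ) (y : ℝ) :
    ev c (Fin.snoc (fun i : Fin B => (Fin.append (Fin.snoc (fun i : Fin B => w (Fin.castAdd 1 (Fin.castSucc i))) y)
      (fun _ : Fin 1 => w (Fin.castAdd 1 (Fin.last B))) : Fin (B + 1 + 1) → ℝ) (Fin.castAdd 1 (Fin.castSucc i)))
      ((Fin.append (Fin.snoc (fun i : Fin B => w (Fin.castAdd 1 (Fin.castSucc i))) y)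
      (fun _ : Fin 1 => w (Fin.castAdd 1 (Fin.last B))) : Fin (B + 1 + 1) → ℝ) (Fin.natAdd (B + 1) 0)) :
      Fin (B + 1) → ℝ) = affF B 1 c w := by
  rw [outBase_inPt]
  rfl

/-- Evaluation of a full-base form at the output base vector `(x', t')` of an input point, split
into its `x'`-part and its `t'`-part. -/
theorem ev_outBase (c : (Fin (B + 1) → ℚ) × ℚ) (z : Fin (B + 1 + 1) → ℝ) :
    ev c (Fin.snoc (fun i : Fin B => z (Fin.castAdd 1 (Fin.castSucc i))) (z (Fin.natAdd (B + 1) 0)) :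
      Fin (B + 1) → ℝ) = affB B 1 (restr B c) z + (c.1 (Fin.last B) : ℝ) * z (Fin.natAdd (B + 1) 0) := by
  simp only [ev, affB, restr, Fin.sum_univ_castSucc, Fin.snoc_castSucc, Fin.snoc_last]
  ring

/-- Full-base forms at an output point with prescribed base vector. -/
theorem affF_append (c : (Fin (B + 1) → ℚ) × ℚ) (q : Fin (B + 1) → ℝ) (v : Fin 1 → ℝ) :
    affF B 1 c (Fin.append q v) = ev c q := by
  simp only [affF, ev, Fin.append_left]

/-- `x'`-affine forms at the output point over the output base vector of an input point. -/
theorem affB_append_outBase (d : (Fin B → ℚ) × ℚ) (z : Fin (B + 1 + 1) → ℝ) (v : Fin 1 → ℝ) :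
    affB B 1 d (Fin.append (Fin.snoc (fun i : Fin B => z (Fin.castAdd 1 (Fin.castSucc i)))
      (z (Fin.natAdd (B + 1) 0)) : Fin (B + 1) → ℝ) v) = affB B 1 d z := by
  simp only [affB, Fin.append_left, Fin.snoc_castSucc]

/-- The value `B` as an index of `Fin (B + 3)` (position of `y` in the order `(x', y, t', σ)`). -/
theorem val_iy : ((Fin.castSucc (Fin.castAdd 1 (Fin.last B)) : Fin (B + 1 + 1 + 1)) : ℕ) = B := by
  simp

/-- The value `B + 1` as an index of `Fin (B + 3)` (position of `t'` in the order `(x', y, t', σ)`). -/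
theorem val_it : ((Fin.castSucc (Fin.natAdd (B + 1) (0 : Fin 1)) : Fin (B + 1 + 1 + 1)) : ℕ) = B + 1 := by
  simp

/-- The value `B + 2` as an index of `Fin (B + 3)` (position of `σ` in the order `(x', y, t', σ)`). -/
theorem val_iσ : ((Fin.last (B + 1 + 1) : Fin (B + 1 + 1 + 1)) : ℕ) = B + 1 + 1 := by
  simp

/-- **The 3-cycle of the last three coordinates.** For `w = (x', t', σ, y)`,
`w ∘ e₃ = (x', y, t', σ) = snoc (inPt (init w) (w last)) σ`, where
`e₃ = swap(y-slot, t'-slot) ∘ swap(t'-slot, σ-slot)` (indices in the order `(x', y, t', σ)`). -/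
theorem comp_cycle3 (w : Fin (B + 1 + 1 + 1) → ℝ) :
    (fun i => w (((Equiv.swap (Fin.castSucc (Fin.castAdd 1 (Fin.last B)) : Fin (B + 1 + 1 + 1))
        (Fin.castSucc (Fin.natAdd (B + 1) (0 : Fin 1)))).trans
      (Equiv.swap (Fin.castSucc (Fin.natAdd (B + 1) (0 : Fin 1))) (Fin.last (B + 1 + 1)))) i)) =
    Fin.snoc (Fin.append (Fin.snoc (fun i : Fin B => Fin.init w (Fin.castAdd 1 (Fin.castSucc i)))
        (w (Fin.last (B + 1 + 1))))
      (fun _ : Fin 1 => Fin.init w (Fin.castAdd 1 (Fin.last B))) : Fin (B + 1 + 1) → ℝ)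
      (Fin.init w (Fin.natAdd (B + 1) (0 : Fin 1))) := by
  have hvy := val_iy (B := B)
  have hvt := val_it (B := B)
  have hvσ := val_iσ (B := B)
  have hyt : (Fin.castSucc (Fin.castAdd 1 (Fin.last B)) : Fin (B + 1 + 1 + 1)) ≠
      Fin.castSucc (Fin.natAdd (B + 1) (0 : Fin 1)) := fun h => by
    have := congrArg Fin.val h; rw [hvy, hvt] at this; omega
  have hyσ : (Fin.castSucc (Fin.castAdd 1 (Fin.last B)) : Fin (B + 1 + 1 + 1)) ≠
      Fin.last (B + 1 + 1) := fun h => by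
    have := congrArg Fin.val h; rw [hvy, hvσ] at this; omega
  have htσ : (Fin.castSucc (Fin.natAdd (B + 1) (0 : Fin 1)) : Fin (B + 1 + 1 + 1)) ≠
      Fin.last (B + 1 + 1) := fun h => by
    have := congrArg Fin.val h; rw [hvt, hvσ] at this; omega
  funext i
  refine Fin.lastCases (n := B + 1 + 1) ?_ (fun j => ?_) i
  · -- the last slot of `(x', y, t', σ)` is `σ`
    rw [Fin.snoc_last, Equiv.trans_apply, Equiv.swap_apply_of_ne_of_ne hyσ.symm htσ.symm,
      Equiv.swap_apply_right]
    rfl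
  · rw [Fin.snoc_castSucc]
    refine Fin.addCases (m := B + 1) (n := 1) (fun j' => ?_) (fun k => ?_) j
    · refine Fin.lastCases (n := B) ?_ (fun i' => ?_) j'
      · -- the `y`-slot
        rw [inPt_y, Equiv.trans_apply, Equiv.swap_apply_left, Equiv.swap_apply_left]
      · -- an `x'`-slot is fixed
        have hne1 : (Fin.castSucc (Fin.castAdd 1 (Fin.castSucc i')) : Fin (B + 1 + 1 + 1)) ≠
            Fin.castSucc (Fin.castAdd 1 (Fin.last B)) := fun h => by
          have := congrArg Fin.val h
          rw [hvy] at this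
          simp at this
          omega
        have hne2 : (Fin.castSucc (Fin.castAdd 1 (Fin.castSucc i')) : Fin (B + 1 + 1 + 1)) ≠
            Fin.castSucc (Fin.natAdd (B + 1) (0 : Fin 1)) := fun h => by
          have := congrArg Fin.val h
          rw [hvt] at this
          simp at this
          omega
        have hne3 : (Fin.castSucc (Fin.castAdd 1 (Fin.castSucc i')) : Fin (B + 1 + 1 + 1)) ≠
            Fin.last (B + 1 + 1) := fun h => by
          have := congrArg Fin.val h
          rw [hvσ] at this
          simp at this
          omega
        rw [inPt_x, Equiv.trans_apply, Equiv.swap_apply_of_ne_of_ne hne1 hne2,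
          Equiv.swap_apply_of_ne_of_ne hne2 hne3]
        rfl
    · -- the `t'`-slot
      have hk : k = 0 := Subsingleton.elim k 0
      subst hk
      rw [inPt_t, Equiv.trans_apply, Equiv.swap_apply_right, Equiv.swap_apply_of_ne_of_ne hyt hyσ]
      rfl

/-- A bound for `x'`-affine forms on coordinatewise bounded points. -/
theorem abs_affB_le (d : (Fin B → ℚ) × ℚ) {z : Fin (B + 1 + 1) → ℝ} {R : ℝ}
    (hz : ∀ i : Fin B, |z (Fin.castAdd 1 (Fin.castSucc i))| ≤ R) :
    |affB B 1 d z| ≤ (∑ i, |(d.1 i : ℝ)|) * R + |(d.2 : ℝ)| := by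
  unfold affB
  refine (abs_add_le _ _).trans (add_le_add ?_ le_rfl)
  refine (Finset.abs_sum_le_sum_abs _ _).trans ?_
  rw [Finset.sum_mul]
  refine Finset.sum_le_sum fun i _ => ?_
  rw [abs_mul]
  exact mul_le_mul_of_nonneg_left (hz i) (abs_nonneg _)

/-- **Boundedness of the output literal domain.** If the input band (domain of `s₂`, membership
described by the output rows `M₃` at `(x', t')` and the `y`-section `(ylo(x'), yhi(x'))`) is
bounded and its `y`-sections over the output base cell are non-empty (`ylo < yhi` on the rows),
then the output literal domain `{rows M₃, A < σ < Bf}` is bounded. -/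
theorem isBounded_outDom {m₃ : ℕ} (s₂ : KZ.IntegralRep (B + 1 + 1)) (M₃ : Fin m₃ → (Fin (B + 1) → ℚ) × ℚ)
    (A Bf : (Fin (B + 1) → ℚ) × ℚ) (ylo yhi : (Fin B → ℚ) × ℚ) (hbd : Bornology.IsBounded s₂.domain)
    (hd₂ : ∀ z, z ∈ s₂.domain ↔ (∀ j, 0 < ev (M₃ j) (Fin.snoc (fun i : Fin B => z (Fin.castAdd 1 (Fin.castSucc i)))
      (z (Fin.natAdd (B + 1) 0)) : Fin (B + 1) → ℝ)) ∧ affB B 1 ylo z < z (Fin.castAdd 1 (Fin.last B)) ∧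
      z (Fin.castAdd 1 (Fin.last B)) < affB B 1 yhi z)
    (hne : ∀ w : Fin (B + 1 + 1) → ℝ, (∀ j, 0 < affF B 1 (M₃ j) w) → affB B 1 ylo w < affB B 1 yhi w) :
    Bornology.IsBounded (gDom B 1 m₃ M₃ (fun _ => Sum.inr A) (fun _ => Sum.inr Bf)) := by
  obtain ⟨R, -, hR⟩ := hbd.exists_pos_norm_le
  set RA : ℝ := (∑ j, |(A.1 j : ℝ)|) * R + |(A.2 : ℝ)| with hRA
  set RB : ℝ := (∑ j, |(Bf.1 j : ℝ)|) * R + |(Bf.2 : ℝ)| with hRB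
  rw [isBounded_iff_forall_norm_le]
  refine ⟨max (max R 0) (max RA RB), fun w hw => ?_⟩
  rw [mem_gDom_one] at hw
  obtain ⟨hrow, h1, h2⟩ := hw
  -- an input point over the same output base point
  set y : ℝ := (affB B 1 ylo w + affB B 1 yhi w) / 2 with hy
  set z : Fin (B + 1 + 1) → ℝ := Fin.append (Fin.snoc (fun i : Fin B => w (Fin.castAdd 1 (Fin.castSucc i))) y)
    (fun _ : Fin 1 => w (Fin.castAdd 1 (Fin.last B))) with hz
  have hzD : z ∈ s₂.domain := by
    rw [hd₂, hz, outBase_inPt, affB_inPt, affB_inPt, inPt_y]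
    have hlt := hne w hrow
    exact ⟨hrow, by rw [hy]; linarith, by rw [hy]; linarith⟩
  have hRz := hR z hzD
  have hbase : ∀ j : Fin (B + 1), |w (Fin.castAdd 1 j)| ≤ R := by
    intro j
    refine Fin.lastCases ?_ (fun i => ?_) j
    · have h := norm_le_pi_norm z (Fin.natAdd (B + 1) 0)
      rw [Real.norm_eq_abs, hz, inPt_t] at h
      exact h.trans hRz
    · have h := norm_le_pi_norm z (Fin.castAdd 1 (Fin.castSucc i))
      rw [Real.norm_eq_abs, hz, inPt_x] at h
      exact h.trans hRz
  rw [pi_norm_le_iff_of_nonneg (le_trans (le_max_right R 0) (le_max_left _ _))]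
  intro l
  rw [Real.norm_eq_abs]
  refine Fin.addCases (fun j => ((hbase j).trans (le_max_left _ _)).trans (le_max_left _ _)) (fun i => ?_) l
  rw [Subsingleton.elim i 0]
  have hA := abs_affF_le A hbase
  have hB := abs_affF_le Bf hbase
  refine le_trans ?_ (le_max_right _ _)
  rw [abs_le] at hA hB ⊢
  constructor
  · exact le_trans (by linarith [le_max_left RA RB] : -max RA RB ≤ -RA) (by linarith)
  · exact le_trans (by linarith : w (Fin.natAdd (B + 1) 0) ≤ RB) (le_max_right _ _)

end Coords

end RebasePos

/-- **Registered support goal of this file**: the 3-cycle of the last three coordinates of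
`ℝ^{B+3}` transports the order `(x', t', σ, y)` to `(x', y, t', σ)` (`RebasePos.comp_cycle3`). -/
theorem rebaseSimplePos_compCycle3 (B : ℕ) (w : Fin (B + 1 + 1 + 1) → ℝ) : (fun i => w (((Equiv.swap (Fin.castSucc (Fin.castAdd 1 (Fin.last B)) : Fin (B + 1 + 1 + 1)) (Fin.castSucc (Fin.natAdd (B + 1) (0 : Fin 1)))).trans (Equiv.swap (Fin.castSucc (Fin.natAdd (B + 1) (0 : Fin 1))) (Fin.last (B + 1 + 1)))) i)) = Fin.snoc (Fin.append (Fin.snoc (fun i : Fin B => Fin.init w (Fin.castAdd 1 (Fin.castSucc i))) (w (Fin.last (B + 1 + 1)))) (fun _ : Fin 1 => Fin.init w (Fin.castAdd 1 (Fin.last B))) : Fin (B + 1 + 1) → ℝ) (Fin.init w (Fin.natAdd (B + 1) (0 : Fin 1))) :=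
  RebasePos.comp_cycle3 w

end Summit.KontsevichZagierPeriods.ArrangementNormalForm.JanusBands
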